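import Literature.NumberTheory.Automorphic.LocalPiSchwartzBruhatFourier
import Literature.NumberTheory.Automorphic.SchwartzBruhatL2Norm
import Mathlib.MeasureTheory.Integral.Prod
import Mathlib.MeasureTheory.Integral.Bochner.ContinuousLinearMap
import Mathlib.Topology.Instances.Matrix
import HarnessLib

/-!
# The Plancherel formula for the Fourier transform of `𝒮(F^ι)` at a finite place

Topic `NumberTheory/Automorphic`; namespace `Literature.NumberTheory.Automorphic`.  KERNEL ONLY: theorems; no definition,
no named fact, no `sorry`.  Sequel of `LocalPiSchwartzBruhatFourier.lean` (the Fourier transform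
`Φ̂(η) = ∫ ψ(⟨x, η⟩) Φ(x) dμ(x)` of a Schwartz–Bruhat function on `F^ι`, `piFourierSB`, and the INVERSION FORMULA
`(Φ̂)̂ = c · Φ(−·)`, `c = piSelfDualConst F ι μ m = μ(𝒪^ι) μ((𝔭^m)^ι)`, `piFourierSB_piFourierSB_eq`).

For a non-archimedean local field `F`, a finite `ι`, a continuous non-trivial character `ψ` of conductor exponent `m`,
and a Haar measure `μ` on `F^ι`:

* §1 Fubini for the kernel `(x, η) ↦ ψ(⟨x, η⟩) Φ(x) G(η)`, `Φ, G ∈ 𝒮(F^ι)` (continuous with compact support on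
  `F^ι × F^ι`): `∫ Φ̂ · G = ∫_x Φ(x) ∫_η ψ(⟨x, η⟩) G(η)` (`integral_piFourierSB_mul`);
* §2 **PLANCHEREL** `integral_piFourierSB_mul_conj`: `∫ Φ̂ · conj Φ̂ dμ = c · ∫ Φ · conj Φ dμ` — from §1 with
  `G = conj Φ̂`, `conj ψ(t) = ψ(−t)`, and the inversion formula at `−x` ([WeilBNT1967, Chap. VII §2, Cor. 1]; [Weil1964,
  Chap. I n° 11]: `Φ ↦ Φ*` is an automorphism of `𝒮` and — for the self-dual measure, `c = 1` — unitary for `L²`,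
  [Tate1950, Thm 2.2.2]);
* §3 the same for the `L²` norm of `SchwartzBruhatL2Norm.lean`: **`l2NormSq_piFourierSB`**,
  `‖Φ̂‖²_{L²(μ)} = c · ‖Φ‖²_{L²(μ)}` (so `c^{−1/2} Φ ↦ Φ̂` is an `L²`-ISOMETRY of `𝒮(F^ι)`; `c = 1` for the self-dual `μ`).

Use (GR-1 Track 2, Hodge/COR-CM cell): the Fourier operator implements the Weyl element of `Sp(F^ι ⊕ F^ι)` on the
Schrödinger model ([Weil1964, n° 13]); with the Levi and unipotent operators (isometric by change of variables /
unimodular multipliers) every symplectic element gets an `L²`-isometric implementer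
(`HeisenbergGroup/SchrodingerPiIsometricImplementers.lean`).  Nothing is cited as a hypothesis.

## References
* [WeilBNT1967] A. Weil, *Basic Number Theory* (1967), Chap. VII §2, Prop. 2, Cor. 1.
* [Tate1950] J. Tate, *Fourier analysis in number fields and Hecke's zeta-functions*, §2.2, Thm 2.2.2.
* [Weil1964] A. Weil, Acta Math. 111 (1964), Chap. I n° 11, n° 13.
-/

set_option autoImplicit false

noncomputable section

open _root_.MeasureTheory _root_.MeasureTheory.Measure Set Function
open scoped ENNReal NNReal ComplexConjugate

namespace Literature.NumberTheory.Automorphic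

open Literature.NumberTheory.GaloisRepresentations.IsNonarchimedeanLocalField

variable {F : Type*} [Field F] [ValuativeRel F] [TopologicalSpace F] [IsNonarchimedeanLocalField F]
  {ι : Type*} [Fintype ι]
  [MeasurableSpace (ι → F)] [BorelSpace (ι → F)] (μ : Measure (ι → F)) [μ.IsAddHaarMeasure]
  {ψ : AddChar F Circle} {m : ℤ}

/-! ## §0 Topological bookkeeping on `F^ι` -/

omit [MeasurableSpace (ι → F)] [BorelSpace (ι → F)] in
/-- `F^ι` is locally compact, Hausdorff and second countable (so `σ`-compact); recorded as local instances.
[folklore] -/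
private theorem secondCountableTopology_pi : SecondCountableTopology (ι → F) := by
  haveI : SecondCountableTopology F := secondCountableTopology_localField F
  infer_instance

omit [Fintype ι] [MeasurableSpace (ι → F)] [BorelSpace (ι → F)] in
/-- `F^ι` is locally compact. [folklore] -/
private theorem locallyCompactSpace_pi [Finite ι] : LocallyCompactSpace (ι → F) := by
  haveI : LocallyCompactSpace F := (isLocalField F).toLocallyCompactSpace
  infer_instance

omit [Fintype ι] [MeasurableSpace (ι → F)] [BorelSpace (ι → F)] in
/-- `F^ι` is Hausdorff. [folklore] -/
private theorem t2Space_pi : T2Space (ι → F) := by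
  haveI : T2Space F := (isLocalField F).toT2Space
  infer_instance

omit [ValuativeRel F] [TopologicalSpace F] [IsNonarchimedeanLocalField F] in
/-- `conj ψ(t) = ψ(−t)` in `ℂ`. [folklore] -/
private theorem conj_coe_addChar (t : F) : conj ((ψ t : Circle) : ℂ) = ((ψ (-t) : Circle) : ℂ) := by
  rw [AddChar.map_neg_eq_inv, Circle.coe_inv_eq_conj]

/-! ## §1 Fubini for the Fourier kernel against a Schwartz–Bruhat function -/

omit [μ.IsAddHaarMeasure] in
/-- the kernel `(η, x) ↦ ψ(⟨x, η⟩) Φ(x) G(η)` is integrable on `F^ι × F^ι` for `Φ, G ∈ 𝒮(F^ι)` (continuous with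
compact support; `μ` finite on compacts). [cite: WeilBNT1967, Chap. VII §2, Prop. 2] -/
theorem integrable_fourierKernel [IsFiniteMeasureOnCompacts μ] (hψ : ψ.IsContinuousNontrivial)
    {Φ G : (ι → F) → ℂ} (hΦ : Φ ∈ SchwartzBruhat (ι → F)) (hG : G ∈ SchwartzBruhat (ι → F)) :
    Integrable (uncurry fun (η x : ι → F) => ((ψ (x ⬝ᵥ η) : Circle) : ℂ) * Φ x * G η) (μ.prod μ) := by
  haveI := secondCountableTopology_pi (F := F) (ι := ι)
  haveI := locallyCompactSpace_pi (F := F) (ι := ι)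
  haveI := t2Space_pi (F := F) (ι := ι)
  haveI : ContinuousMul F := (isLocalField F).toIsTopologicalDivisionRing.toContinuousMul
  haveI : ContinuousAdd F := (isLocalField F).toIsTopologicalDivisionRing.toContinuousAdd
  have hcont : Continuous (uncurry fun (η x : ι → F) => ((ψ (x ⬝ᵥ η) : Circle) : ℂ) * Φ x * G η) := by
    have h1 : Continuous fun p : (ι → F) × (ι → F) => ((ψ (p.2 ⬝ᵥ p.1) : Circle) : ℂ) :=
      continuous_subtype_val.comp (hψ.1.comp (continuous_snd.dotProduct continuous_fst))
    exact (h1.mul (hΦ.1.continuous.comp continuous_snd)).mul (hG.1.continuous.comp continuous_fst)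
  refine hcont.integrable_of_hasCompactSupport ?_
  refine HasCompactSupport.intro (hG.2.prod hΦ.2) ?_
  rintro ⟨η, x⟩ hp
  rw [Set.mem_prod, not_and_or] at hp
  simp only [uncurry_apply_pair]
  rcases hp with hη | hx
  · rw [image_eq_zero_of_notMem_tsupport hη, mul_zero]
  · rw [image_eq_zero_of_notMem_tsupport hx, mul_zero, zero_mul]

omit [μ.IsAddHaarMeasure] in
/-- **Fubini for the Fourier transform against a Schwartz–Bruhat function**:
`∫ Φ̂(η) G(η) dμ(η) = ∫_x Φ(x) (∫_η ψ(⟨x, η⟩) G(η) dμ(η)) dμ(x)` for `Φ, G ∈ 𝒮(F^ι)`.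
[cite: WeilBNT1967, Chap. VII §2, Prop. 2] -/
theorem integral_piFourierSB_mul [IsFiniteMeasureOnCompacts μ] [SigmaFinite μ] (hψ : ψ.IsContinuousNontrivial)
    {Φ G : (ι → F) → ℂ} (hΦ : Φ ∈ SchwartzBruhat (ι → F)) (hG : G ∈ SchwartzBruhat (ι → F)) :
    ∫ η, piFourierSB ψ μ Φ η * G η ∂μ = ∫ x, Φ x * ∫ η, ((ψ (x ⬝ᵥ η) : Circle) : ℂ) * G η ∂μ ∂μ := by
  have hswap := integral_integral_swap (integrable_fourierKernel μ hψ hΦ hG)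
  calc ∫ η, piFourierSB ψ μ Φ η * G η ∂μ
      = ∫ η, ∫ x, ((ψ (x ⬝ᵥ η) : Circle) : ℂ) * Φ x * G η ∂μ ∂μ := by
        refine integral_congr_ae (Filter.Eventually.of_forall fun η => ?_)
        simp only [piFourierSB_apply]
        rw [← integral_mul_const]
    _ = ∫ x, ∫ η, ((ψ (x ⬝ᵥ η) : Circle) : ℂ) * Φ x * G η ∂μ ∂μ := hswap
    _ = ∫ x, Φ x * ∫ η, ((ψ (x ⬝ᵥ η) : Circle) : ℂ) * G η ∂μ ∂μ := by
        refine integral_congr_ae (Filter.Eventually.of_forall fun x => ?_)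
        simp only
        rw [← integral_const_mul]
        refine integral_congr_ae (Filter.Eventually.of_forall fun η => ?_)
        simp only
        ring

/-! ## §2 Plancherel: `∫ Φ̂ conj Φ̂ = c ∫ Φ conj Φ` -/

omit [ValuativeRel F] [TopologicalSpace F] [IsNonarchimedeanLocalField F] [BorelSpace (ι → F)] [μ.IsAddHaarMeasure] in
/-- `∫_η ψ(⟨x, η⟩) conj(G(η)) dμ = conj(Ĝ(−x))`. [cite: WeilBNT1967, Chap. VII §2, Prop. 2] -/
private theorem integral_addChar_mul_conj (x : ι → F) (G : (ι → F) → ℂ) :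
    ∫ η, ((ψ (x ⬝ᵥ η) : Circle) : ℂ) * conj (G η) ∂μ = conj (piFourierSB ψ μ G (-x)) := by
  rw [piFourierSB_apply, ← integral_conj]
  refine integral_congr_ae (Filter.Eventually.of_forall fun η => ?_)
  simp only [map_mul, conj_coe_addChar, dotProduct_neg, neg_neg]
  rw [dotProduct_comm]

/-- **PLANCHEREL FOR `𝒮(F^ι)`**: `∫ Φ̂ · conj Φ̂ dμ = c · ∫ Φ · conj Φ dμ` with `c = μ(𝒪^ι) μ((𝔭^m)^ι)` the constant
of the inversion formula (`c = 1` for the self-dual measure).  Proof: Fubini against `G = conj Φ̂ ∈ 𝒮(F^ι)`,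
`∫_η ψ(⟨x, η⟩) conj Φ̂(η) = conj((Φ̂)̂(−x)) = c · conj Φ(x)` by inversion. [cite: WeilBNT1967, Chap. VII §2, Cor. 1]
[cite: Tate1950, Thm 2.2.2] -/
theorem integral_piFourierSB_mul_conj (hψ : ψ.IsContinuousNontrivial) (hm : ψ.HasConductorExp m)
    {Φ : (ι → F) → ℂ} (hΦ : Φ ∈ SchwartzBruhat (ι → F)) :
    ∫ η, piFourierSB ψ μ Φ η * conj (piFourierSB ψ μ Φ η) ∂μ =
      (piSelfDualConst F ι μ m : ℂ) * ∫ x, Φ x * conj (Φ x) ∂μ := by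
  haveI := secondCountableTopology_pi (F := F) (ι := ι)
  haveI := locallyCompactSpace_pi (F := F) (ι := ι)
  haveI := t2Space_pi (F := F) (ι := ι)
  have hΨ : piFourierSB ψ μ Φ ∈ SchwartzBruhat (ι → F) := piFourierSB_mem_schwartzBruhat μ hψ hΦ
  have hG : (fun η => conj (piFourierSB ψ μ Φ η)) ∈ SchwartzBruhat (ι → F) :=
    ⟨hΨ.1.comp _, hΨ.2.comp_left (map_zero _)⟩
  rw [integral_piFourierSB_mul μ hψ hΦ hG, ← integral_const_mul]
  refine integral_congr_ae (Filter.Eventually.of_forall fun x => ?_)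
  simp only
  rw [integral_addChar_mul_conj μ x, congr_fun (piFourierSB_piFourierSB_eq μ hψ hm hΦ) (-x), neg_neg, map_mul,
    Complex.conj_ofReal]
  ring

/-! ## §3 Plancherel for the `L²` norm of `𝒮(F^ι)` -/

omit [Field F] [ValuativeRel F] [IsNonarchimedeanLocalField F] [Fintype ι] [μ.IsAddHaarMeasure] in
/-- `∫ Φ conj Φ dμ = ∫⁻ |Φ|² dμ` (as a real number cast to `ℂ`) for `Φ ∈ 𝒮(F^ι)`. [folklore] -/
private theorem integral_mul_conj_eq_lintegral [IsFiniteMeasureOnCompacts μ] {Φ : (ι → F) → ℂ}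
    (hΦ : Φ ∈ SchwartzBruhat (ι → F)) :
    ∫ x, Φ x * conj (Φ x) ∂μ = ((∫⁻ x, ‖Φ x‖ₑ ^ 2 ∂μ).toReal : ℂ) := by
  have h1 : (fun x => Φ x * conj (Φ x)) = fun x => ((‖Φ x‖ ^ 2 : ℝ) : ℂ) := by
    funext x
    rw [Complex.mul_conj, Complex.normSq_eq_norm_sq]
  rw [h1, integral_complex_ofReal]
  congr 1
  have hint : Integrable (fun x => ‖Φ x‖ ^ 2) μ := by
    refine Continuous.integrable_of_hasCompactSupport ((continuous_norm.comp hΦ.1.continuous).pow 2) ?_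
    exact (hΦ.2.norm).comp_left (g := fun t : ℝ => t ^ 2) (zero_pow two_ne_zero)
  rw [integral_eq_lintegral_of_nonneg_ae (Filter.Eventually.of_forall fun x => sq_nonneg _)
    hint.aestronglyMeasurable]
  congr 1
  refine lintegral_congr fun x => ?_
  rw [← ofReal_norm, ENNReal.ofReal_pow (norm_nonneg _)]

omit [Field F] [ValuativeRel F] [IsNonarchimedeanLocalField F] [Fintype ι] [BorelSpace (ι → F)]
  [μ.IsAddHaarMeasure] in
/-- `∫⁻ |Φ|² dμ < ∞` for `Φ ∈ 𝒮(F^ι)`. [folklore] -/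
private theorem lintegral_enorm_sq_schwartzBruhat_lt_top [IsFiniteMeasureOnCompacts μ] {Φ : (ι → F) → ℂ}
    (hΦ : Φ ∈ SchwartzBruhat (ι → F)) : ∫⁻ x, ‖Φ x‖ₑ ^ 2 ∂μ < ∞ :=
  SchwartzBruhat.l2NormSq_lt_top μ ⟨Φ, hΦ⟩

/-- **PLANCHEREL, `L²` form**: `∫⁻ |Φ̂|² dμ = c · ∫⁻ |Φ|² dμ`, `c = piSelfDualConst F ι μ m`.
[cite: WeilBNT1967, Chap. VII §2, Cor. 1] [cite: Tate1950, Thm 2.2.2] -/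
theorem lintegral_enorm_sq_piFourierSB (hψ : ψ.IsContinuousNontrivial) (hm : ψ.HasConductorExp m)
    {Φ : (ι → F) → ℂ} (hΦ : Φ ∈ SchwartzBruhat (ι → F)) :
    ∫⁻ η, ‖piFourierSB ψ μ Φ η‖ₑ ^ 2 ∂μ = ENNReal.ofReal (piSelfDualConst F ι μ m) * ∫⁻ x, ‖Φ x‖ₑ ^ 2 ∂μ := by
  haveI := secondCountableTopology_pi (F := F) (ι := ι)
  haveI := locallyCompactSpace_pi (F := F) (ι := ι)
  haveI := t2Space_pi (F := F) (ι := ι)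
  have hΨ : piFourierSB ψ μ Φ ∈ SchwartzBruhat (ι → F) := piFourierSB_mem_schwartzBruhat μ hψ hΦ
  have h := integral_piFourierSB_mul_conj μ hψ hm hΦ
  rw [integral_mul_conj_eq_lintegral μ hΨ, integral_mul_conj_eq_lintegral μ hΦ, ← Complex.ofReal_mul,
    Complex.ofReal_inj] at h
  have hc : 0 ≤ piSelfDualConst F ι μ m := (piSelfDualConst_pos μ).le
  rw [← ENNReal.ofReal_toReal (lintegral_enorm_sq_schwartzBruhat_lt_top μ hΨ).ne,
    ← ENNReal.ofReal_toReal (lintegral_enorm_sq_schwartzBruhat_lt_top μ hΦ).ne, h, ENNReal.ofReal_mul hc]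

/-- **PLANCHEREL for the Fourier automorphism of `𝒮(F^ι)`** (`piFourierEquivSB`):
`‖Φ̂‖²_{L²(μ)} = c ‖Φ‖²_{L²(μ)}`. [cite: Weil1964, Chap. I n° 11] [cite: WeilBNT1967, Chap. VII §2, Cor. 1] -/
theorem l2NormSq_piFourierEquivSB (hψ : ψ.IsContinuousNontrivial) (hm : ψ.HasConductorExp m)
    (Φ : SchwartzBruhat (ι → F)) :
    SchwartzBruhat.l2NormSq μ (piFourierEquivSB μ hψ hm Φ) =
      ENNReal.ofReal (piSelfDualConst F ι μ m) * SchwartzBruhat.l2NormSq μ Φ := by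
  rw [SchwartzBruhat.l2NormSq_def, SchwartzBruhat.l2NormSq_def, coe_piFourierEquivSB]
  exact lintegral_enorm_sq_piFourierSB μ hψ hm Φ.2

end Literature.NumberTheory.Automorphic

end
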